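import Summits.QuantumFields.YangMills.Theorems.MirrorModularBoostsHypercubicLimitPeelBlanketProductTwo
import Summits.QuantumFields.YangMills.Theorems.PencilRigidityHypercubicLimitDefs
import HarnessLib

/-!
# Crux `HypercubicLimit` (stmt-QuantumFields-16154), line `peel-and-disseminate`: (F′) from its pressure form

Support file (`--supports stmt-QuantumFields-16154`) proving the registered sub-goal
`blanketProductBound_of_expMoment` of the line `peel-and-disseminate` (skeleton
`Cruxes/HypercubicLimit/Lines/peel_and_disseminate.lean`): the kernel-checked bridge from the PRESSURE
(exponential-moment) form of the blanket product bound to the product form (F′).  With `μ` Wilson's measure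
on the torus of side `2S+1`, `Zₖ := E[δpₖ | exterior of Q_R(xₖ)]`, `Yₖ := E[|Zₖ| | exterior of Q_{λR}(xₖ)]`
and `I₂(k) := ‖Zₖ‖₂ = influence r β S R (x k) (o k).1 (o k).2 2`: if
`∫ exp(t Σₖ Yₖ / I₂(k)) dμ ≤ exp(c n)` for some `t > 0` and `c` (same guards), then
`∫ ∏ₖ Yₖ dμ ≤ ∏ₖ (e^c / (e t)) · I₂(k)`.

Proof (elementary): `u ≤ exp(u - 1)` (`Real.add_one_le_exp`) at `u = t y / I` gives `y ≤ I/(e t) · exp(t y / I)`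
for `I > 0`; a factor with `I₂(k) = 0` has `Zₖ = 0` a.e., hence `Yₖ = 0` a.e.; all factors are a.e. nonnegative
(`condExp_nonneg`), so the product of the factorwise bounds is `∏ Yₖ ≤ (∏ I₂(k)/(e t)) · exp(t Σ Yₖ/I₂(k))`
a.e.; integrate (the right side is a.e. bounded since `|δpₖ| ≤ 2N`, `ae_bdd_abs_condExp_of_ae_bdd_abs`) and
use the hypothesis.

Refs: Williams 1991 §9.7 (positivity and contractivity of conditional expectation); card
`Cruxes/HypercubicLimit/Ideas/peel-and-disseminate.md`.
-/

set_option autoImplicit false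

noncomputable section

open scoped SchwartzMap ENNReal
open MeasureTheory Filter Topology
open Literature.MathematicalPhysics.AQFT Literature.MathematicalPhysics.QuantumLattice
open Literature.MathematicalPhysics.QuantumFieldTheory
open Literature.Probability.LatticeModels (box Site)
open Summit.QuantumFields.YangMills.Theorems.HypercubicLimit.Negative (torusPlaquette rpSquare influence exterior)
open Summit.QuantumFields.YangMills.Cruxes.HypercubicLimit.ConditionalMeanTelescoping (GapData)

namespace Summit.QuantumFields.YangMills.Cruxes.HypercubicLimit.PeelAndDisseminate

open Summit.QuantumFields.YangMills.Theorems.HypercubicLimit.Negative (measurable_torusPlaquette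
  abs_centred_torusPlaquette_le)

/-! ## The elementary inequality and its integrated product form -/

/-- **`y ≤ I/(e t) · exp(t y / I)`** for `t > 0`, `I > 0` and every real `y`: the tangent-line inequality
`u ≤ exp(u - 1)` (`Real.add_one_le_exp`) at `u = t y / I`. [folklore] -/
theorem le_div_mul_exp {y I t : ℝ} (ht : 0 < t) (hI : 0 < I) :
    y ≤ I / (Real.exp 1 * t) * Real.exp (t * (y / I)) := by
  have he : 0 < Real.exp 1 := Real.exp_pos 1
  have h1 : t * (y / I) ≤ Real.exp (t * (y / I) - 1) := by
    have := Real.add_one_le_exp (t * (y / I) - 1)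
    linarith
  rw [Real.exp_sub, le_div_iff₀ he] at h1
  calc y = I / (Real.exp 1 * t) * (t * (y / I) * Real.exp 1) := by field_simp
    _ ≤ I / (Real.exp 1 * t) * Real.exp (t * (y / I)) := by gcongr

/-- **Product bound from an exponential moment** (a.e. form).  For a.e. nonnegative `Yₖ`, constants `Iₖ ≥ 0`
with `Yₖ = 0` a.e. whenever `Iₖ = 0`, `t > 0`, and an integrable exponential moment
`∫ exp(t Σₖ Yₖ/Iₖ) dμ ≤ exp(c n)`: `∫ ∏ₖ Yₖ dμ ≤ ∏ₖ (e^c/(e t)) Iₖ` — multiply the factorwise bounds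
`Yₖ ≤ Iₖ/(e t) · exp(t Yₖ/Iₖ)` (`le_div_mul_exp`) and integrate. [folklore] -/
theorem integral_prod_le_of_expMoment {Ω : Type*} {mΩ : MeasurableSpace Ω} {μ : Measure Ω} {n : ℕ}
    (Y : Fin n → Ω → ℝ) (I : Fin n → ℝ) {t c : ℝ} (ht : 0 < t)
    (hY0 : ∀ k, 0 ≤ᵐ[μ] Y k) (hI0 : ∀ k, 0 ≤ I k) (hdeg : ∀ k, I k = 0 → Y k =ᵐ[μ] 0)
    (hint : Integrable (fun ω => Real.exp (t * ∑ k, Y k ω / I k)) μ)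
    (hE : ∫ ω, Real.exp (t * ∑ k, Y k ω / I k) ∂μ ≤ Real.exp (c * n)) :
    ∫ ω, ∏ k, Y k ω ∂μ ≤ ∏ k, Real.exp c / (Real.exp 1 * t) * I k := by
  -- factorwise bound, a.e.
  have hfac : ∀ k, ∀ᵐ ω ∂μ, Y k ω ≤ I k / (Real.exp 1 * t) * Real.exp (t * (Y k ω / I k)) := by
    intro k
    rcases (hI0 k).eq_or_lt with h0 | hpos
    · filter_upwards [hdeg k h0.symm] with ω hω
      rw [hω, ← h0, Pi.zero_apply, zero_div, zero_mul]
    · exact ae_of_all _ fun ω => le_div_mul_exp ht hpos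
  have hfac' : ∀ᵐ ω ∂μ, ∀ k, Y k ω ≤ I k / (Real.exp 1 * t) * Real.exp (t * (Y k ω / I k)) :=
    ae_all_iff.2 hfac
  have hY0' : ∀ᵐ ω ∂μ, ∀ k, 0 ≤ Y k ω := ae_all_iff.2 fun k => (hY0 k).mono fun ω h => h
  -- the product of the factorwise bounds
  have hprod : ∀ᵐ ω ∂μ, ∏ k, Y k ω ≤
      (∏ k, I k / (Real.exp 1 * t)) * Real.exp (t * ∑ k, Y k ω / I k) := by
    filter_upwards [hfac', hY0'] with ω hω hω0
    calc ∏ k, Y k ω ≤ ∏ k, (I k / (Real.exp 1 * t) * Real.exp (t * (Y k ω / I k))) :=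
          Finset.prod_le_prod (fun k _ => hω0 k) fun k _ => hω k
      _ = (∏ k, I k / (Real.exp 1 * t)) * Real.exp (t * ∑ k, Y k ω / I k) := by
          rw [Finset.prod_mul_distrib, Finset.mul_sum, Real.exp_sum]
  have hnn : 0 ≤ᵐ[μ] fun ω => ∏ k, Y k ω := by
    filter_upwards [hY0'] with ω hω0
    exact Finset.prod_nonneg fun k _ => hω0 k
  have hK : 0 ≤ ∏ k, I k / (Real.exp 1 * t) :=
    Finset.prod_nonneg fun k _ => div_nonneg (hI0 k) (mul_pos (Real.exp_pos 1) ht).le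
  have hexp : Real.exp (c * n) = ∏ _k : Fin n, Real.exp c := by
    rw [Fin.prod_const, ← Real.exp_nat_mul, mul_comm]
  calc ∫ ω, ∏ k, Y k ω ∂μ
      ≤ ∫ ω, (∏ k, I k / (Real.exp 1 * t)) * Real.exp (t * ∑ k, Y k ω / I k) ∂μ :=
        integral_mono_of_nonneg hnn (hint.const_mul _) hprod
    _ = (∏ k, I k / (Real.exp 1 * t)) * ∫ ω, Real.exp (t * ∑ k, Y k ω / I k) ∂μ :=
        integral_const_mul _ _
    _ ≤ (∏ k, I k / (Real.exp 1 * t)) * Real.exp (c * n) := mul_le_mul_of_nonneg_left hE hK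
    _ = ∏ k, Real.exp c / (Real.exp 1 * t) * I k := by
        rw [hexp, ← Finset.prod_mul_distrib]
        exact Finset.prod_congr rfl fun k _ => by ring

/-- **Product bound from an exponential moment, conditional-expectation form.**  On a finite measure space,
for bounded measurable `Xₖ` and σ-algebras `m₁ k`, `m₂ k`, put `Zₖ := E[Xₖ | m₁ k]`, `Yₖ := E[|Zₖ| | m₂ k]`,
`Iₖ := ‖Zₖ‖₂`.  If `∫ exp(t Σₖ Yₖ/Iₖ) dμ ≤ exp(c n)` with `t > 0`, then `∫ ∏ₖ Yₖ dμ ≤ ∏ₖ (e^c/(e t)) Iₖ`: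
`Yₖ ≥ 0` a.e. (`condExp_nonneg`), `Iₖ = 0 ⇒ Zₖ = 0` a.e. `⇒ Yₖ = 0` a.e., and the exponential is a.e.
bounded (`ae_bdd_abs_condExp_of_ae_bdd_abs`), hence integrable (Williams 1991 §9.7). [folklore] -/
theorem integral_prod_condExp_le_of_expMoment {Ω : Type*} {m₀ : MeasurableSpace Ω} {μ : Measure Ω}
    [IsFiniteMeasure μ] {n : ℕ} (m₁ m₂ : Fin n → MeasurableSpace Ω) (X : Fin n → Ω → ℝ) {B : ℝ}
    (hXm : ∀ k, AEStronglyMeasurable (X k) μ) (hXb : ∀ k ω, |X k ω| ≤ B) {t c : ℝ} (ht : 0 < t)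
    (hE : ∫ ω, Real.exp (t * ∑ k, (μ[fun ω => |(μ[X k | m₁ k]) ω| | m₂ k]) ω /
        (eLpNorm (μ[X k | m₁ k]) 2 μ).toReal) ∂μ ≤ Real.exp (c * n)) :
    ∫ ω, ∏ k, (μ[fun ω => |(μ[X k | m₁ k]) ω| | m₂ k]) ω ∂μ ≤
      ∏ k, Real.exp c / (Real.exp 1 * t) * (eLpNorm (μ[X k | m₁ k]) 2 μ).toReal := by
  -- nonnegativity of the factors and of the norms
  have hY0 : ∀ k, 0 ≤ᵐ[μ] μ[fun ω => |(μ[X k | m₁ k]) ω| | m₂ k] :=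
    fun k => condExp_nonneg (ae_of_all _ fun ω => abs_nonneg _)
  have hI0 : ∀ k, 0 ≤ (eLpNorm (μ[X k | m₁ k]) 2 μ).toReal := fun k => ENNReal.toReal_nonneg
  -- the conditional means have finite `L²` seminorm
  have hZ2 : ∀ k, eLpNorm (μ[X k | m₁ k]) 2 μ ≠ ∞ := by
    intro k
    refine ne_top_of_le_ne_top ?_ (eLpNorm_condExp_le_eLpNorm _ one_le_two)
    refine (MemLp.of_bound (p := 2) (hXm k) B (ae_of_all _ fun ω => ?_)).eLpNorm_ne_top
    rw [Real.norm_eq_abs]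
    exact hXb k ω
  -- degenerate factors vanish a.e.
  have hdeg : ∀ k, (eLpNorm (μ[X k | m₁ k]) 2 μ).toReal = 0 →
      μ[fun ω => |(μ[X k | m₁ k]) ω| | m₂ k] =ᵐ[μ] 0 := by
    intro k hk
    have h0 : eLpNorm (μ[X k | m₁ k]) 2 μ = 0 :=
      ((ENNReal.toReal_eq_zero_iff _).1 hk).resolve_right (hZ2 k)
    have hZ0 : μ[X k | m₁ k] =ᵐ[μ] 0 :=
      (eLpNorm_eq_zero_iff integrable_condExp.aestronglyMeasurable two_ne_zero).1 h0
    have habs : (fun ω => |(μ[X k | m₁ k]) ω|) =ᵐ[μ] (0 : Ω → ℝ) := by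
      filter_upwards [hZ0] with ω hω
      rw [hω, Pi.zero_apply, abs_zero]
    exact (condExp_congr_ae habs).trans (by rw [condExp_zero])
  -- the factors are a.e. bounded by `B`
  have hYb : ∀ k, ∀ᵐ ω ∂μ, |(μ[fun ω => |(μ[X k | m₁ k]) ω| | m₂ k]) ω| ≤ B := by
    intro k
    refine ae_bdd_abs_condExp_of_ae_bdd_abs ?_
    have hZb : ∀ᵐ ω ∂μ, |(μ[X k | m₁ k]) ω| ≤ B :=
      ae_bdd_abs_condExp_of_ae_bdd_abs (ae_of_all _ fun ω => hXb k ω)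
    filter_upwards [hZb] with ω hω
    rwa [abs_abs]
  -- hence the exponential moment is integrable
  have hYm : ∀ k, AEStronglyMeasurable (μ[fun ω => |(μ[X k | m₁ k]) ω| | m₂ k]) μ :=
    fun k => integrable_condExp.aestronglyMeasurable
  have hint : Integrable (fun ω => Real.exp (t * ∑ k, (μ[fun ω => |(μ[X k | m₁ k]) ω| | m₂ k]) ω /
      (eLpNorm (μ[X k | m₁ k]) 2 μ).toReal)) μ := by
    refine Integrable.of_bound ?_ (Real.exp (t * ∑ k, B / (eLpNorm (μ[X k | m₁ k]) 2 μ).toReal)) ?_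
    · refine (Real.measurable_exp.comp_aemeasurable ?_).aestronglyMeasurable
      refine (Finset.aemeasurable_fun_sum _ fun k _ => ?_).const_mul t
      exact (hYm k).aemeasurable.div_const _
    · filter_upwards [ae_all_iff.2 hYb] with ω hω
      rw [Real.norm_eq_abs, Real.abs_exp]
      refine Real.exp_le_exp.2 (mul_le_mul_of_nonneg_left (Finset.sum_le_sum fun k _ => ?_) ht.le)
      exact div_le_div_of_nonneg_right ((le_abs_self _).trans (hω k)) (hI0 k)
  exact integral_prod_le_of_expMoment (μ := μ) (fun k => μ[fun ω => |(μ[X k | m₁ k]) ω| | m₂ k])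
    (fun k => (eLpNorm (μ[X k | m₁ k]) 2 μ).toReal) ht hY0 hI0 hdeg hint hE

/-! ## The registered sub-goal -/

/-- **(F′) from its PRESSURE form** (registered sub-goal `blanketProductBound_of_expMoment`): a blanket EXPONENTIAL-MOMENT bound
`∫ exp(t Σₖ Yₖ/I₂(k)) dμ ≤ exp(c n)` (some `t > 0`, `c`, same guards) implies the blanket product bound (F′) with `C = e^c/(e t)`,
by `y ≤ e^{ty}/(e t)` for `y ≥ 0` factor by factor (`Yₖ ≥ 0`, `I₂(k) ≥ 0`; a factor with `I₂(k) = 0` has `Yₖ = 0` a.e.). -/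
theorem blanketProductBound_of_expMoment :
    (∀ (G : Type) [Group G] [TopologicalSpace G] [IsTopologicalGroup G] [CompactSpace G]
      [MeasurableSpace G] [BorelSpace G], IsCompactSimpleLieGroup G →
      ∀ (r : LatticeRep G) (β₁ C₁ c₂ : ℝ) (m : ℝ → ℝ), GapData G r β₁ C₁ c₂ m →
        ∀ c₀ : ℝ, 0 < c₀ → ∃ (lam : ℕ) (t c β₀ : ℝ), 1 ≤ lam ∧ 0 < t ∧ ∀ β : ℝ, β₀ ≤ β → ∀ n : ℕ,
          ∃ S₀ : ℕ, ∀ S : ℕ, S₀ ≤ S →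
            ∀ (R : ℕ) (o : Fin n → Fin 4 × Fin 4) (x : Fin n → Site 4),
              (∀ k, (o k).1 ≠ (o k).2) → 1 ≤ R → (R : ℝ) ≤ c₀ / m β → 4 * (lam * R) + 4 < 2 * S + 1 →
              (∀ k l, k ≠ l → ∃ μ : Fin 4, (2 * (lam * R) + 1 : ℤ) < |x k μ - x l μ| ∧ |x k μ - x l μ| ≤ S) →
                ∫ U, Real.exp (t * ∑ k, ((wilsonMeasure r.ρ β : Measure (GaugeConfig 4 (2 * S + 1) G))[fun U =>
                    |((wilsonMeasure r.ρ β : Measure (GaugeConfig 4 (2 * S + 1) G))[fun U =>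
                        torusPlaquette r (2 * S + 1) (o k).1 (o k).2 (x k) U -
                          ∫ V, torusPlaquette r (2 * S + 1) (o k).1 (o k).2 (x k) V
                            ∂(wilsonMeasure r.ρ β : Measure (GaugeConfig 4 (2 * S + 1) G)) |
                      (exterior (2 * S + 1) R (x k) : MeasurableSpace (GaugeConfig 4 (2 * S + 1) G))]) U| |
                    (exterior (2 * S + 1) (lam * R) (x k) : MeasurableSpace (GaugeConfig 4 (2 * S + 1) G))]) U /
                    influence r β S R (x k) (o k).1 (o k).2 2)
                  ∂(wilsonMeasure r.ρ β : Measure (GaugeConfig 4 (2 * S + 1) G)) ≤ Real.exp (c * n)) →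
    ∀ (G : Type) [Group G] [TopologicalSpace G] [IsTopologicalGroup G] [CompactSpace G]
      [MeasurableSpace G] [BorelSpace G], IsCompactSimpleLieGroup G →
      ∀ (r : LatticeRep G) (β₁ C₁ c₂ : ℝ) (m : ℝ → ℝ), GapData G r β₁ C₁ c₂ m →
        ∀ c₀ : ℝ, 0 < c₀ → ∃ (lam : ℕ) (C β₀ : ℝ), 1 ≤ lam ∧ ∀ β : ℝ, β₀ ≤ β → ∀ n : ℕ,
          ∃ S₀ : ℕ, ∀ S : ℕ, S₀ ≤ S →
            ∀ (R : ℕ) (o : Fin n → Fin 4 × Fin 4) (x : Fin n → Site 4),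
              (∀ k, (o k).1 ≠ (o k).2) → 1 ≤ R → (R : ℝ) ≤ c₀ / m β → 4 * (lam * R) + 4 < 2 * S + 1 →
              (∀ k l, k ≠ l → ∃ μ : Fin 4, (2 * (lam * R) + 1 : ℤ) < |x k μ - x l μ| ∧ |x k μ - x l μ| ≤ S) →
                ∫ U, ∏ k, ((wilsonMeasure r.ρ β : Measure (GaugeConfig 4 (2 * S + 1) G))[fun U =>
                    |((wilsonMeasure r.ρ β : Measure (GaugeConfig 4 (2 * S + 1) G))[fun U =>
                        torusPlaquette r (2 * S + 1) (o k).1 (o k).2 (x k) U -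
                          ∫ V, torusPlaquette r (2 * S + 1) (o k).1 (o k).2 (x k) V
                            ∂(wilsonMeasure r.ρ β : Measure (GaugeConfig 4 (2 * S + 1) G)) |
                      (exterior (2 * S + 1) R (x k) : MeasurableSpace (GaugeConfig 4 (2 * S + 1) G))]) U| |
                    (exterior (2 * S + 1) (lam * R) (x k) : MeasurableSpace (GaugeConfig 4 (2 * S + 1) G))]) U
                  ∂(wilsonMeasure r.ρ β : Measure (GaugeConfig 4 (2 * S + 1) G)) ≤
                ∏ k, C * influence r β S R (x k) (o k).1 (o k).2 2 := by
  intro hF G _ _ _ _ _ _ hG r β₁ C₁ c₂ m hgap c₀ hc₀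
  obtain ⟨lam, t, c, β₀, hlam, ht, hF'⟩ := hF G hG r β₁ C₁ c₂ m hgap c₀ hc₀
  refine ⟨lam, Real.exp c / (Real.exp 1 * t), β₀, hlam, fun β hβ n => ?_⟩
  obtain ⟨S₀, hS₀⟩ := hF' β hβ n
  refine ⟨S₀, fun S hS R o x ho hR hRm hguard hsep => ?_⟩
  have hE := hS₀ S hS R o x ho hR hRm hguard hsep
  haveI := isProbabilityMeasure_wilsonMeasure (d := 4) (L := 2 * S + 1) r.ρ r.continuous β
  -- the centred plaquettes are measurable and bounded by `2N`
  have hXm : ∀ k : Fin n, AEStronglyMeasurable (fun U : GaugeConfig 4 (2 * S + 1) G =>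
      torusPlaquette r (2 * S + 1) (o k).1 (o k).2 (x k) U -
        ∫ V, torusPlaquette r (2 * S + 1) (o k).1 (o k).2 (x k) V
          ∂(wilsonMeasure r.ρ β : Measure (GaugeConfig 4 (2 * S + 1) G)))
      (wilsonMeasure r.ρ β : Measure (GaugeConfig 4 (2 * S + 1) G)) :=
    fun k => ((measurable_torusPlaquette r _ _ _ _).sub measurable_const).aestronglyMeasurable
  have hXb : ∀ (k : Fin n) (U : GaugeConfig 4 (2 * S + 1) G),
      |torusPlaquette r (2 * S + 1) (o k).1 (o k).2 (x k) U -
        ∫ V, torusPlaquette r (2 * S + 1) (o k).1 (o k).2 (x k) V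
          ∂(wilsonMeasure r.ρ β : Measure (GaugeConfig 4 (2 * S + 1) G))| ≤ 2 * r.N :=
    fun k U => abs_centred_torusPlaquette_le r _ _ _ _ _ U
  exact integral_prod_condExp_le_of_expMoment (μ := (wilsonMeasure r.ρ β : Measure (GaugeConfig 4 (2 * S + 1) G)))
    (fun k => (exterior (2 * S + 1) R (x k) : MeasurableSpace (GaugeConfig 4 (2 * S + 1) G)))
    (fun k => (exterior (2 * S + 1) (lam * R) (x k) : MeasurableSpace (GaugeConfig 4 (2 * S + 1) G)))
    (fun k U => torusPlaquette r (2 * S + 1) (o k).1 (o k).2 (x k) U -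
      ∫ V, torusPlaquette r (2 * S + 1) (o k).1 (o k).2 (x k) V
        ∂(wilsonMeasure r.ρ β : Measure (GaugeConfig 4 (2 * S + 1) G)))
    hXm hXb ht hE

end Summit.QuantumFields.YangMills.Cruxes.HypercubicLimit.PeelAndDisseminate

end
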